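import Summits.BirchSwinnertonDyer.BirchSwinnertonDyer.Theses.SylvesterTwoHeegnerIndex
import Summits.BirchSwinnertonDyer.BirchSwinnertonDyer.Theorems.SylvesterTwoHeegnerIndexFirstLayerSplit
import Summits.BirchSwinnertonDyer.BirchSwinnertonDyer.Theorems.SylvesterTwoHeegnerIndexCoupledUpperBoundReductionSeven
import Summits.BirchSwinnertonDyer.BirchSwinnertonDyer.Theorems.SylvesterTwoHeegnerIndexCoupledDescentFirstLayerFourOfL1
import Summits.BirchSwinnertonDyer.BirchSwinnertonDyer.Theorems.SylvesterTwoHeegnerIndexCoupledDescentFirstLayerSevenOfL1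
import Summits.BirchSwinnertonDyer.BirchSwinnertonDyer.Theorems.SylvesterTwoHeegnerIndexCoupledDescentBottomClassInvariance

/-! # Skeleton VARIANT L for crux `UpperOffV0HSYPlus` (stmt-BirchSwinnertonDyer-19804) —
«LEAF (L1) / TAIL SPLIT of the coupled bounds, by residue class» (planner bsd-cm-plan g27, 2026-08-28, D439;
reshaping of VARIANT K `Lines/coupled_variantK.lean` 9a39a679fe96c65a after k7t-c2 g21's landings #16–#19:
the two FIRST-LAYER stubs of VARIANT K are now CLOSED BY NAME from leaf (L1) — p647879
`firstLayerFour_of_L1 (hL1) : <stub_firstLayerFour verbatim>` and p648983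
`firstLayerSeven_of_thmC_of_L1 (hC) (hL1) : <stub_firstLayerSeven verbatim>` — so they are replaced here by
their one remaining input, the strictly weaker `stub_L1Four` / `stub_L1Seven` = leaf (L1) of p620148
(`SylvesterTwoHeegnerIndexCoupledDescentKolyvagin`) for EVERY non-2-divisible bottom point Y₀ ∈ E_p(K), K any
quadratic number field ∋ ω, levels := conductors, Kol := the (L3) files' eight clauses; by p647458 `hL1_of_hL1`
that family is (L1) for ONE point (the rows' CM bottom point P₁^{χ_B}) + its non-2-divisibility. VARIANT K stays
in the folder as the coarser reading; composition `UpperOffV0HSYPlus_of` is VARIANT K's verbatim with the two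
first-layer stubs now theorems (`firstLayerFour_closed`, `firstLayerSeven_closed`). Registered stubs (FIVE, each a
genuine piece with its own row): `stub_L1Four` / `stub_L1Seven` (row k-p1: the coupled CM-frame Kolyvagin classes
— k-ty1 recipe terms R0–R8 — with their off-level local conditions (one call each: ∞ tree, v ∣ 3p k-ty1 #8/#9,
good v ∤ 9pn incl. v ∣ 2 #10/#11, w ∣ 3 for B on 7 (9) #12 mod the (★) datum) and the two AT-LEVEL FLIP iffs at
λ (memo two §57.3; shell k-ty1 g6 #14) = the research piece), `stub_tailFour` / `stub_tailSeven` (row k-p2,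
unchanged), `stub_thmC` (= item 19802, unchanged). Director-bsd g12 gating of record HOME/INBOX.md l.212
unchanged. Nothing is asserted; no stub is closed by this file; BSD is not claimed. -/

set_option linter.dupNamespace false

open scoped Classical
open WeierstrassCurve Literature.NumberTheory.EllipticCurves

namespace Summit.BirchSwinnertonDyer.BirchSwinnertonDyer.Cruxes.UpperOffV0HSYPlus.CoupledVariantL

open Summit.BirchSwinnertonDyer.BirchSwinnertonDyer.Theses.SylvesterTwoHeegnerIndex
open Summit.BirchSwinnertonDyer.BirchSwinnertonDyer.Theorems
open Summit.BirchSwinnertonDyer.BirchSwinnertonDyer.Theorems.SylvesterTwoCoupledUpperBound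
open Summit.BirchSwinnertonDyer.BirchSwinnertonDyer.Theorems.SylvesterTwoFirstLayerSplit
open Summit.BirchSwinnertonDyer.BirchSwinnertonDyer.Theorems.SylvesterTwoCoupledDescentCebotarev
open NumberField IsDedekindDomain Literature.NumberTheory.EllipticCurves.HuShuYin2019

/-- **stub (row k-p1, p ≡ 4 (9)) — LEAF (L1) for every non-2-divisible bottom point** (p620148's (L1) binder verbatim at the conductor levels; VARIANT K's `stub_firstLayerFour` follows by `firstLayerFour_of_L1`) [size L; research piece = the two AT-LEVEL FLIP iffs at λ]. -/
theorem stub_L1Four : ∀ (p : ℕ), p.Prime → p % 9 = 4 → (¬ ∃ x : ZMod p, x ^ 3 = 3) →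
      ∀ (K : Type) [Field K] [NumberField K] (ω : K), ω ^ 2 + ω + 1 = 0 →
        Module.finrank ℚ K = 2 →
      ∀ Y₀ : ((cubeSumCurve (p : ℚ)).baseChange K).toAffine.Point,
        (¬ ∃ Q : ((cubeSumCurve (p : ℚ)).baseChange K).toAffine.Point, (2 : ℕ) • Q = Y₀) →
      ∃ (cA : ℕ → galH1Torsion ((cubeSumCurve (3 * (p : ℚ) ^ 2)).baseChange K) (2 : ℕ))
        (cB : ℕ → galH1Torsion ((cubeSumCurve (p : ℚ)).baseChange K) (2 : ℕ)),
      (∀ ℓ, (ℓ.Prime ∧ ¬ ℓ ∣ (cubeSumCurve (3 * (p : ℚ) ^ 2)).conductorNorm ℤ ∧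
          ¬ ℓ ∣ (cubeSumCurve (p : ℚ)).conductorNorm ℤ ∧ ¬ ((ℓ : ℤ) ∣ NumberField.discr K) ∧ ℓ ≠ 2 ∧
          (Ideal.span {(ℓ : 𝓞 K)}).IsPrime ∧
          FrobEqFrobInfty (cubeSumCurve (3 * (p : ℚ) ^ 2)) K 2 ℓ ∧
          FrobEqFrobInfty (cubeSumCurve (p : ℚ)) K 2 ℓ) →
        (∀ v : HeightOneSpectrum (𝓞 K), (ℓ : 𝓞 K) ∉ v.asIdeal →
          cA ℓ ∈ selmerLocalKer ((cubeSumCurve (3 * (p : ℚ) ^ 2)).baseChange K)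
            (v.adicCompletion K) (2 : ℕ)) ∧
        (∀ x : InfinitePlace K, cA ℓ ∈ selmerLocalKer
          ((cubeSumCurve (3 * (p : ℚ) ^ 2)).baseChange K) x.Completion (2 : ℕ)) ∧
        (∀ v : HeightOneSpectrum (𝓞 K), (ℓ : 𝓞 K) ∈ v.asIdeal →
          (cA ℓ ∈ selmerLocalKer ((cubeSumCurve (3 * (p : ℚ) ^ 2)).baseChange K)
              (v.adicCompletion K) (2 : ℕ) ↔
            kummerClassOfPoint (cubeSumCurve (p : ℚ)) K Nat.prime_two Y₀ ∈
              ((cubeSumCurve (p : ℚ)).baseChange K).torsionLocalKer (v.adicCompletion K) (2 : ℕ)))) ∧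
      (∀ ℓ ℓ', (ℓ.Prime ∧ ¬ ℓ ∣ (cubeSumCurve (3 * (p : ℚ) ^ 2)).conductorNorm ℤ ∧
          ¬ ℓ ∣ (cubeSumCurve (p : ℚ)).conductorNorm ℤ ∧ ¬ ((ℓ : ℤ) ∣ NumberField.discr K) ∧ ℓ ≠ 2 ∧
          (Ideal.span {(ℓ : 𝓞 K)}).IsPrime ∧
          FrobEqFrobInfty (cubeSumCurve (3 * (p : ℚ) ^ 2)) K 2 ℓ ∧
          FrobEqFrobInfty (cubeSumCurve (p : ℚ)) K 2 ℓ) →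
        (ℓ'.Prime ∧ ¬ ℓ' ∣ (cubeSumCurve (3 * (p : ℚ) ^ 2)).conductorNorm ℤ ∧
          ¬ ℓ' ∣ (cubeSumCurve (p : ℚ)).conductorNorm ℤ ∧ ¬ ((ℓ' : ℤ) ∣ NumberField.discr K) ∧
          ℓ' ≠ 2 ∧ (Ideal.span {(ℓ' : 𝓞 K)}).IsPrime ∧
          FrobEqFrobInfty (cubeSumCurve (3 * (p : ℚ) ^ 2)) K 2 ℓ' ∧
          FrobEqFrobInfty (cubeSumCurve (p : ℚ)) K 2 ℓ') → ℓ ≠ ℓ' →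
        (∀ v : HeightOneSpectrum (𝓞 K), (ℓ : 𝓞 K) ∉ v.asIdeal → (ℓ' : 𝓞 K) ∉ v.asIdeal →
          cB (ℓ * ℓ') ∈ selmerLocalKer ((cubeSumCurve (p : ℚ)).baseChange K)
            (v.adicCompletion K) (2 : ℕ)) ∧
        (∀ x : InfinitePlace K,
          cB (ℓ * ℓ') ∈ selmerLocalKer ((cubeSumCurve (p : ℚ)).baseChange K) x.Completion (2 : ℕ)) ∧
        (∀ v : HeightOneSpectrum (𝓞 K), (ℓ : 𝓞 K) ∈ v.asIdeal →
          (cB (ℓ * ℓ') ∈ selmerLocalKer ((cubeSumCurve (p : ℚ)).baseChange K)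
              (v.adicCompletion K) (2 : ℕ) ↔
            cA ℓ' ∈ ((cubeSumCurve (3 * (p : ℚ) ^ 2)).baseChange K).torsionLocalKer
              (v.adicCompletion K) (2 : ℕ)))) := by
  sorry

/-- **stub (row k-p1, p ≡ 7 (9)) — LEAF (L1) for every non-2-divisible bottom point.** -/
theorem stub_L1Seven : ∀ (p : ℕ), p.Prime → p % 9 = 7 → (¬ ∃ x : ZMod p, x ^ 3 = 3) →
      ∀ (K : Type) [Field K] [NumberField K] (ω : K), ω ^ 2 + ω + 1 = 0 →
        Module.finrank ℚ K = 2 →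
      ∀ Y₀ : ((cubeSumCurve (p : ℚ)).baseChange K).toAffine.Point,
        (¬ ∃ Q : ((cubeSumCurve (p : ℚ)).baseChange K).toAffine.Point, (2 : ℕ) • Q = Y₀) →
      ∃ (cA : ℕ → galH1Torsion ((cubeSumCurve (3 * (p : ℚ) ^ 2)).baseChange K) (2 : ℕ))
        (cB : ℕ → galH1Torsion ((cubeSumCurve (p : ℚ)).baseChange K) (2 : ℕ)),
      (∀ ℓ, (ℓ.Prime ∧ ¬ ℓ ∣ (cubeSumCurve (3 * (p : ℚ) ^ 2)).conductorNorm ℤ ∧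
          ¬ ℓ ∣ (cubeSumCurve (p : ℚ)).conductorNorm ℤ ∧ ¬ ((ℓ : ℤ) ∣ NumberField.discr K) ∧ ℓ ≠ 2 ∧
          (Ideal.span {(ℓ : 𝓞 K)}).IsPrime ∧
          FrobEqFrobInfty (cubeSumCurve (3 * (p : ℚ) ^ 2)) K 2 ℓ ∧
          FrobEqFrobInfty (cubeSumCurve (p : ℚ)) K 2 ℓ) →
        (∀ v : HeightOneSpectrum (𝓞 K), (ℓ : 𝓞 K) ∉ v.asIdeal →
          cA ℓ ∈ selmerLocalKer ((cubeSumCurve (3 * (p : ℚ) ^ 2)).baseChange K)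
            (v.adicCompletion K) (2 : ℕ)) ∧
        (∀ x : InfinitePlace K, cA ℓ ∈ selmerLocalKer
          ((cubeSumCurve (3 * (p : ℚ) ^ 2)).baseChange K) x.Completion (2 : ℕ)) ∧
        (∀ v : HeightOneSpectrum (𝓞 K), (ℓ : 𝓞 K) ∈ v.asIdeal →
          (cA ℓ ∈ selmerLocalKer ((cubeSumCurve (3 * (p : ℚ) ^ 2)).baseChange K)
              (v.adicCompletion K) (2 : ℕ) ↔
            kummerClassOfPoint (cubeSumCurve (p : ℚ)) K Nat.prime_two Y₀ ∈
              ((cubeSumCurve (p : ℚ)).baseChange K).torsionLocalKer (v.adicCompletion K) (2 : ℕ)))) ∧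
      (∀ ℓ ℓ', (ℓ.Prime ∧ ¬ ℓ ∣ (cubeSumCurve (3 * (p : ℚ) ^ 2)).conductorNorm ℤ ∧
          ¬ ℓ ∣ (cubeSumCurve (p : ℚ)).conductorNorm ℤ ∧ ¬ ((ℓ : ℤ) ∣ NumberField.discr K) ∧ ℓ ≠ 2 ∧
          (Ideal.span {(ℓ : 𝓞 K)}).IsPrime ∧
          FrobEqFrobInfty (cubeSumCurve (3 * (p : ℚ) ^ 2)) K 2 ℓ ∧
          FrobEqFrobInfty (cubeSumCurve (p : ℚ)) K 2 ℓ) →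
        (ℓ'.Prime ∧ ¬ ℓ' ∣ (cubeSumCurve (3 * (p : ℚ) ^ 2)).conductorNorm ℤ ∧
          ¬ ℓ' ∣ (cubeSumCurve (p : ℚ)).conductorNorm ℤ ∧ ¬ ((ℓ' : ℤ) ∣ NumberField.discr K) ∧
          ℓ' ≠ 2 ∧ (Ideal.span {(ℓ' : 𝓞 K)}).IsPrime ∧
          FrobEqFrobInfty (cubeSumCurve (3 * (p : ℚ) ^ 2)) K 2 ℓ' ∧
          FrobEqFrobInfty (cubeSumCurve (p : ℚ)) K 2 ℓ') → ℓ ≠ ℓ' →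
        (∀ v : HeightOneSpectrum (𝓞 K), (ℓ : 𝓞 K) ∉ v.asIdeal → (ℓ' : 𝓞 K) ∉ v.asIdeal →
          cB (ℓ * ℓ') ∈ selmerLocalKer ((cubeSumCurve (p : ℚ)).baseChange K)
            (v.adicCompletion K) (2 : ℕ)) ∧
        (∀ x : InfinitePlace K,
          cB (ℓ * ℓ') ∈ selmerLocalKer ((cubeSumCurve (p : ℚ)).baseChange K) x.Completion (2 : ℕ)) ∧
        (∀ v : HeightOneSpectrum (𝓞 K), (ℓ : 𝓞 K) ∈ v.asIdeal →
          (cB (ℓ * ℓ') ∈ selmerLocalKer ((cubeSumCurve (p : ℚ)).baseChange K)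
              (v.adicCompletion K) (2 : ℕ) ↔
            cA ℓ' ∈ ((cubeSumCurve (3 * (p : ℚ) ^ 2)).baseChange K).torsionLocalKer
              (v.adicCompletion K) (2 : ℕ)))) := by
  sorry

/-- **CLOSED from `stub_L1Four` (p647879 `firstLayerFour_of_L1`) — FIRST LAYER, p ≡ 4 (9) = THEOREM K2 typed**: granted the route's facts, for the HSY
pair (B, A) = (E_p, E_{3p²}), `ord₂(#Ш_an(B)·#Ш_an(A)) = 0 ⇒ #Ш(B)[2^∞] = #Ш(A)[2^∞] = 1`
(Kolyvagin at level `M = 1` for the coupled pair; memo two §57; refereed g59/g60). [size L] -/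
theorem firstLayerFour_closed : PublishedFactsTwoPlus →
    ∀ (p : ℕ), p.Prime → p % 9 = 4 → (¬ ∃ x : ZMod p, x ^ 3 = 3) →
      ∀ (A B : WeierstrassCurve ℚ) [A.IsElliptic] [A.IsGloballyMinimal] [B.IsElliptic]
        [B.IsGloballyMinimal], (∃ C : VariableChange ℚ, C • B = HuShuYin2019.cubeSumCurve (p : ℚ)) →
        (∃ C : VariableChange ℚ, C • A = HuShuYin2019.cubeSumCurve (3 * (p : ℚ) ^ 2)) →
        ∀ (qB qA : ℚ), shaAn B = (qB : ℂ) → shaAn A = (qA : ℂ) → qB * qA ≠ 0 →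
          padicValRat 2 (qB * qA) = 0 →
          Nat.card (AddCommGroup.primaryComponent B.sha 2) = 1 ∧
            Nat.card (AddCommGroup.primaryComponent A.sha 2) = 1 :=
  firstLayerFour_of_L1 stub_L1Four

/-- **stub (row k-p2, p ≡ 4 (9)) — TAIL**: the coupled bound `s_B + s_A ≤ ord₂(#Ш_an(B)·#Ш_an(A))` on the
pairs with `4 < #Ш(B)[2^∞]·#Ш(A)[2^∞]` (induction over levels `2^M`, deep Kolyvagin primes; memo two
§64/§65, refereed g61). [size L–XL] -/
theorem stub_tailFour : PublishedFactsTwoPlus →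
    ∀ (p : ℕ), p.Prime → p % 9 = 4 → (¬ ∃ x : ZMod p, x ^ 3 = 3) →
      ∀ (A B : WeierstrassCurve ℚ) [A.IsElliptic] [A.IsGloballyMinimal] [B.IsElliptic]
        [B.IsGloballyMinimal], (∃ C : VariableChange ℚ, C • B = HuShuYin2019.cubeSumCurve (p : ℚ)) →
        (∃ C : VariableChange ℚ, C • A = HuShuYin2019.cubeSumCurve (3 * (p : ℚ) ^ 2)) →
        4 < Nat.card (AddCommGroup.primaryComponent B.sha 2) *
            Nat.card (AddCommGroup.primaryComponent A.sha 2) →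
        ∃ qB qA : ℚ, shaAn B = (qB : ℂ) ∧ shaAn A = (qA : ℂ) ∧ qB * qA ≠ 0 ∧
          (padicValNat 2 (Nat.card (AddCommGroup.primaryComponent B.sha 2)) : ℤ) +
              (padicValNat 2 (Nat.card (AddCommGroup.primaryComponent A.sha 2)) : ℤ) ≤
            padicValRat 2 (qB * qA) := by
  sorry

/-- **stub (item 19802) — THEOREM C typed**: `PublishedFactsTwoPlus → HSYPointTwoDivisibleSevenModNine`
(crux 19802's own skeleton ea25de9eb9afcd52; desk (M-K3-7) bears on its paper form). [size L] -/
theorem stub_thmC : PublishedFactsTwoPlus → SylvesterTwoNonneg.HSYPointTwoDivisibleSevenModNine := by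
  sorry

/-- **CLOSED from `stub_thmC` + `stub_L1Seven` (p648983 `firstLayerSeven_of_thmC_of_L1`) — FIRST LAYER, p ≡ 7 (9) = COROLLARY K2(7) typed** (memo two §67: under THEOREM C's
(★) the Kolyvagin classes are Kummer at 3 and the `M = 1` argument runs verbatim). [size L] -/
theorem firstLayerSeven_closed : PublishedFactsTwoPlus →
    ∀ (p : ℕ), p.Prime → p % 9 = 7 → (¬ ∃ x : ZMod p, x ^ 3 = 3) →
      ∀ (A B : WeierstrassCurve ℚ) [A.IsElliptic] [A.IsGloballyMinimal] [B.IsElliptic]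
        [B.IsGloballyMinimal], (∃ C : VariableChange ℚ, C • B = HuShuYin2019.cubeSumCurve (p : ℚ)) →
        (∃ C : VariableChange ℚ, C • A = HuShuYin2019.cubeSumCurve (3 * (p : ℚ) ^ 2)) →
        ∀ (qB qA : ℚ), shaAn B = (qB : ℂ) → shaAn A = (qA : ℂ) → qB * qA ≠ 0 →
          padicValRat 2 (qB * qA) = 0 →
          Nat.card (AddCommGroup.primaryComponent B.sha 2) = 1 ∧
            Nat.card (AddCommGroup.primaryComponent A.sha 2) = 1 :=
  fun hF ↦ firstLayerSeven_of_thmC_of_L1 (stub_thmC hF) stub_L1Seven hF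

/-- **stub (row k-p2, p ≡ 7 (9)) — TAIL** (THEOREM K3*'s induction on the pairs with
`4 < #Ш(B)[2^∞]·#Ш(A)[2^∞]`; memo two §67–§68, desk (M-K3-7)). [size L–XL] -/
theorem stub_tailSeven : PublishedFactsTwoPlus →
    ∀ (p : ℕ), p.Prime → p % 9 = 7 → (¬ ∃ x : ZMod p, x ^ 3 = 3) →
      ∀ (A B : WeierstrassCurve ℚ) [A.IsElliptic] [A.IsGloballyMinimal] [B.IsElliptic]
        [B.IsGloballyMinimal], (∃ C : VariableChange ℚ, C • B = HuShuYin2019.cubeSumCurve (p : ℚ)) →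
        (∃ C : VariableChange ℚ, C • A = HuShuYin2019.cubeSumCurve (3 * (p : ℚ) ^ 2)) →
        4 < Nat.card (AddCommGroup.primaryComponent B.sha 2) *
            Nat.card (AddCommGroup.primaryComponent A.sha 2) →
        ∃ qB qA : ℚ, shaAn B = (qB : ℂ) ∧ shaAn A = (qA : ℂ) ∧ qB * qA ≠ 0 ∧
          (padicValNat 2 (Nat.card (AddCommGroup.primaryComponent B.sha 2)) : ℤ) +
              (padicValNat 2 (Nat.card (AddCommGroup.primaryComponent A.sha 2)) : ℤ) ≤
            padicValRat 2 (qB * qA) := by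
  sorry

/-- **Composition (kernel-checked)**: the crux BY NAME from the five stubs, through p590593's
`coupledUpperBoundFour_of_firstLayer_of_tail` / `coupledUpperBoundSeven_of_thmC_of_firstLayer_of_tail` and
K3R-7's splice `upperOffV0HSYPlus_of_coupledUpperBounds`. -/
theorem UpperOffV0HSYPlus_of :
    Summit.BirchSwinnertonDyer.BirchSwinnertonDyer.Theses.SylvesterTwoHeegnerIndex.UpperOffV0HSYPlus :=
  fun hF =>
    upperOffV0HSYPlus_of_coupledUpperBounds
      (coupledUpperBoundFour_of_firstLayer_of_tail hF (firstLayerFour_closed hF) (stub_tailFour hF))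
      (coupledUpperBoundSeven_of_thmC_of_firstLayer_of_tail hF (firstLayerSeven_closed hF) (stub_tailSeven hF)
        (stub_thmC hF)) hF

end Summit.BirchSwinnertonDyer.BirchSwinnertonDyer.Cruxes.UpperOffV0HSYPlus.CoupledVariantL
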